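import Summits.QuantumFields.BalabanUV.Beta.BorderedHessianStepStraight

/-!
# (J2), MULTIPLIER ROWS: the step residual `bhKStep (j+1) ∘ KInvStep Lc (j+1)` has the COARSE KRONECKER DELTA as its
# multiplier–multiplier block and a VANISHING multiplier–field block — the border scale `stepScale = M^{d+2}` is the right one
# (β sub-cell, row BETA-an2 = BINDER-OWNERS row D1, gen 15; leaves L1.c-mm and L1.c-mf of `gen15/SKELETON-D1-hR.v2.md`)

HONEST FRAMING (cell charter, verbatim): «discharging BetaPertH makes Balaban's UV stability UNCONDITIONAL — a real
constructive-QFT result; it is NOT the continuum limit and NOT the Clay problem.»  DERIVED cell leaf (pub-balaban β sub-cell, lane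
an2 gen 15); no statement of Bałaban's papers is typed here, no `[cite:]` tag, no `Prop` fact; it instantiates no binder of the
β-function wall by itself.  It proves the two MULTIPLIER-ROW blocks of the step residual (J2); the two FIELD-ROW blocks ((fm) = 0 by an5's
two-level reproduction `wH_reproduction`, (ff) = `1 + gauge` by `GcolSum_decomposition`) remain OPEN leaves (L1.c-fm, L1.c-ff).
NOT `BetaPertH`; NOT continuum; NOT Clay.

## What is here ([folklore]; `M := Lc^{j+1}`, `N := Lc^{j+2} = M·Lc`, `K := KInvStep Lc (j+1) = dec M (KInv N)`)

* §1 the columns of the decimated composite resolvent read as block-contour sums: `fcol_KInvStep_inr_of_coarse` (the multiplier column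
  at an `Lc`-coarse `z` is `M^{−(d+2)}·𝒬_M ℋ_N(·; m, quo z)`, `ResolventComposition.KInvStep_inl_inr`), `fcol_KInvStep_inr_of_not_coarse`
  (`= 0`), `fcol_KInvStep_inl` (the field column is `M^{−2(d+2)}·Σ_{i′} 𝒬_M Γ_N(·; β, p_{i′})` over the source contour block);
* §2 **`comp_bhKStep_KInvStep_inr_inr`**: `(bhKStep (j+1) ∘ K)(x, z, inr κ, inr m) = [x, z coarse]·[quo x = quo z ∧ κ = m]` — by
  `𝒬_{Lc} ∘ 𝒬_M = 𝒬_N` (`contourSum_mul`) and `𝒬_N ℋ_N = δ` (`contourSum_Hcol`); `stepScale (j+1) · M^{−(d+2)} = 1`;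
* §3 **`comp_bhKStep_KInvStep_inr_inl`**: `(bhKStep (j+1) ∘ K)(x, z, inr κ, inl β) = 0` — by `contourSum_mul` and `𝒬_N Γ_N = 0` (`Gam_Q`).
These are the `(inr, ·)` rows of `BorderedHessianResidual.comp_bhK_KInv = resid` one level up (at `j = 0`: `resid_inr_inr` = coarse delta,
`resid_inr_inl = 0`).  All declarations `[folklore]`; axioms standard.  Provenance: b2b-balaban β sub-cell, unit beta-an2 gen 15, 2026-08-20 (v1);
over `BorderedHessianStepStraight` (p206693), `ResolventComposition` (`KInvStep_inl_inr`, `contourSum_mul`, `contourSum_Hcol`,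
`contourSum_const_mul`, `contourSum_finset_sum`), `StepDriftWitness.sum_LegIdx_eq_contourSum`, `KKTFluctuationKernel.Gam_Q`,
`AxialCoordinateProjectorCoarse.KInvStep_inr_off'` BY NAME; no existing file touched.
-/

open Finset
open scoped BigOperators
open Literature.Probability.LatticeModels (TorusSite Torus.proj Torus.proj_apply)
open Literature.MathematicalPhysics.QuantumFieldTheory
open Literature.MathematicalPhysics.QuantumFieldTheory.Balaban1983to89
open Literature.MathematicalPhysics.QuantumFieldTheory.Balaban1983to89.Beta
open B12Sec2to5 (l1 l1_nonneg)
open ExpKernelCalculus (MKer Decays comp)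
open AffineAveraging (Form0 Form1 Form2 box toSite unitVec unitVec_apply dz curv curvAdj codiff₁ contourSum)
open AffineReproduction (contourSumAdj)
open KKTFluctuationKernel (delta1 delta1_apply Gam Gam_Q)
open KernelSpecInstance (wH wΦ)
open LatticeForm (quo)
open OneStepResolventKernel (Fib KInv KInv_inl_inl quo_zsmul eq_zsmul_quo_of_proj proj_zsmul)
open OneStepKernelFamily (KInvStep dec legSet legW legPt LegIdx)
open StepDriftWitness (sum_LegIdx_eq_contourSum)
open ResolventComposition (Hcol Hcol_apply contourSum_Hcol KInvStep_inl_inr contourSum_mul contourSum_const_mul contourSum_finset_sum)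
open BalabanStepJetsSucc (E2 wVH)
open Summit.QuantumFields.BalabanUV.Beta.TameKernelCalculus
open Summit.QuantumFields.BalabanUV.Beta.AxialDressingRooted (KInvStep_inr_off' one_le_of_neZero)

namespace Summit.QuantumFields.BalabanUV.Beta.BorderedHessian

noncomputable section

variable {d : ℕ} {Lc : ℕ} [NeZero Lc]

/-! ## §1 The columns of the decimated composite resolvent as block-contour sums -/

/-- [folklore] The MULTIPLIER COLUMN of `KInvStep Lc j′` at an `Lc`-coarse `z`, read as a fine 1-form on the step lattice:
`M^{−(d+2)} · 𝒬_M ℋ_N(·; m, quo z)` (`M = Lc^{j′}`, `N = Lc^{j′+1}`). -/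
theorem fcol_KInvStep_inr_of_coarse (j' : ℕ) {z : Fin (d + 1) → ℤ} (hz : Torus.proj Lc z = 0) (m : Fin (d + 1)) :
    fcol (KInvStep (d := d) Lc j') z (Sum.inr m) =
      fun l y => (((Lc ^ j' : ℕ) : ℝ) ^ (d + 2))⁻¹ * contourSum (Lc ^ j') (Hcol (N := Lc ^ (j' + 1)) m (quo Lc z)) l y := by
  funext l y
  rw [fcol_apply]
  conv_lhs => rw [eq_zsmul_quo_of_proj hz]
  exact KInvStep_inl_inr Lc j' l m y (quo Lc z)

/-- [folklore] … and at a non-coarse `z` it vanishes. -/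
theorem fcol_KInvStep_inr_of_not_coarse (j' : ℕ) {z : Fin (d + 1) → ℤ} (hz : Torus.proj Lc z ≠ 0) (m : Fin (d + 1)) :
    fcol (KInvStep (d := d) Lc j') z (Sum.inr m) = 0 := by
  funext l y
  rw [fcol_apply]
  exact KInvStep_inr_off' j' hz y (Sum.inl l) m

/-- [folklore] The FIELD COLUMN of `KInvStep Lc j′` at `(inl β, z)`: `M^{−2(d+2)} · Σ_{i′ ∈ LegIdx} 𝒬_M Γ_N(·; β, p_{i′}(z))` — the
block-contour sum in the row variable of the level-`N` covariance columns with sources on the contour block of `(β, z)`. -/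
theorem fcol_KInvStep_inl (j' : ℕ) (z : Fin (d + 1) → ℤ) (β : Fin (d + 1)) :
    fcol (KInvStep (d := d) Lc j') z (Sum.inl β) =
      fun l y => ∑ i' ∈ LegIdx d (Lc ^ j'),
        ((((Lc ^ j' : ℕ) : ℝ) ^ (d + 2))⁻¹ * (((Lc ^ j' : ℕ) : ℝ) ^ (d + 2))⁻¹) *
          contourSum (Lc ^ j') (fun l w => Gam (N := Lc ^ (j' + 1)) l w β (legPt (Lc ^ j') (Sum.inl β) z i')) l y := by
  funext l y
  rw [fcol_apply]
  unfold OneStepKernelFamily.KInvStep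
  simp only [dec, legSet, legW, KInv_inl_inl]
  rw [Finset.sum_comm]
  refine Finset.sum_congr rfl fun i' _ => ?_
  rw [← sum_LegIdx_eq_contourSum, Finset.mul_sum]

/-! ## §2 The multiplier–multiplier block of the step residual is the coarse Kronecker delta -/

/-- [folklore] `stepScale d Lc j′ · ((Lc^{j′})^{d+2})⁻¹ = 1`. -/
theorem stepScale_mul_inv (j' : ℕ) : stepScale d Lc j' * (((Lc ^ j' : ℕ) : ℝ) ^ (d + 2))⁻¹ = 1 := by
  unfold stepScale
  push_cast
  exact mul_inv_cancel₀ (pow_ne_zero _ (pow_ne_zero _ (by exact_mod_cast NeZero.ne Lc)))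

/-- [folklore] **(J2)-mm: THE MULTIPLIER–MULTIPLIER BLOCK OF THE STEP RESIDUAL IS THE COARSE KRONECKER DELTA**:
`(bhKStep (j+1) ∘ KInvStep Lc (j+1))(x, z, inr κ, inr m) = [proj x = 0 ∧ proj z = 0]·[quo x = quo z ∧ κ = m]`. -/
theorem comp_bhKStep_KInvStep_inr_inr (j : ℕ) (x z : Fin (d + 1) → ℤ) (κ m : Fin (d + 1)) :
    comp (bhKStep d Lc (j + 1)) (KInvStep (d := d) Lc (j + 1)) x z (Sum.inr κ) (Sum.inr m) =
      if Torus.proj Lc x = 0 ∧ Torus.proj Lc z = 0 then (if quo Lc x = quo Lc z ∧ κ = m then 1 else 0) else 0 := by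
  have hM : 0 < Lc ^ (j + 1) := pow_pos (Nat.pos_of_ne_zero (NeZero.ne Lc)) _
  rw [comp_bhKStep_succ_inr]
  by_cases hz : Torus.proj Lc z = 0
  · rw [fcol_KInvStep_inr_of_coarse (j + 1) hz m, contourSum_const_mul, ← contourSum_mul (Lc ^ (j + 1)) Lc hM, ← pow_succ,
      contourSum_Hcol]
    by_cases hx : Torus.proj Lc x = 0
    · rw [if_pos hx, ← mul_assoc, stepScale_mul_inv, one_mul,
        if_pos (show Torus.proj Lc x = 0 ∧ Torus.proj Lc z = 0 from ⟨hx, hz⟩)]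
    · rw [if_neg hx, mul_zero, if_neg (show ¬(Torus.proj Lc x = 0 ∧ Torus.proj Lc z = 0) from fun h => hx h.1)]
  · rw [fcol_KInvStep_inr_of_not_coarse (j + 1) hz m, contourSum_zero]
    simp [hz]

/-! ## §3 The multiplier–field block of the step residual vanishes -/

/-- [folklore] **(J2)-mf: THE MULTIPLIER–FIELD BLOCK OF THE STEP RESIDUAL VANISHES**:
`(bhKStep (j+1) ∘ KInvStep Lc (j+1))(x, z, inr κ, inl β) = 0` — `𝒬_{Lc} 𝒬_M = 𝒬_N` and `𝒬_N Γ_N = 0`. -/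
theorem comp_bhKStep_KInvStep_inr_inl (j : ℕ) (x z : Fin (d + 1) → ℤ) (κ β : Fin (d + 1)) :
    comp (bhKStep d Lc (j + 1)) (KInvStep (d := d) Lc (j + 1)) x z (Sum.inr κ) (Sum.inl β) = 0 := by
  have hM : 0 < Lc ^ (j + 1) := pow_pos (Nat.pos_of_ne_zero (NeZero.ne Lc)) _
  rw [comp_bhKStep_succ_inr]
  suffices h : contourSum Lc (fcol (KInvStep (d := d) Lc (j + 1)) z (Sum.inl β)) κ (quo Lc x) = 0 by
    rw [h]; simp
  rw [fcol_KInvStep_inl (j + 1) z β, contourSum_finset_sum]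
  refine Finset.sum_eq_zero fun i' _ => ?_
  rw [contourSum_const_mul, ← contourSum_mul (Lc ^ (j + 1)) Lc hM, ← pow_succ, Gam_Q, mul_zero]

end

end Summit.QuantumFields.BalabanUV.Beta.BorderedHessian
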